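import Literature.Geometry.Lorentzian.CoordCurvatureDerivatives
import Literature.Geometry.Lorentzian.CoordBochner
import Literature.Geometry.Lorentzian.CoordInnerLaplacian
import HarnessLib

/-!
# The wave equation satisfied by the deformation tensor of a covector field:
# `□ 𝓛_ξ g = Rm ∗ 𝓛_ξ g` on a Ricci-flat background when `□ ξ = 0`

A further layer of the rank-generic coordinate tensor calculus (`CoordTensorCalculus`,
`CoordTensorRicciIdentity`, `CoordBianchi`, `CoordCurvatureLaplacian`, `CoordCurvatureDerivatives`):
metric components `G : E → (E →L E →L ℝ)` of any signature, smooth, symmetric and nondegenerate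
on an open set `V` (`IsMetricOn G V`), a basis `b` of `E`, covariant derivative `tcov` (`∇`), metric
trace `ttr`, rough Laplacian / d'Alembertian `tlap` (`□ = tr ∇²`), curvature components `rm4`
(`R_{jkim}`), inverse metric coefficients `ginv` (`g^{ij}`).

For a smooth covector field with components `T` (index type `Unit`, `T_m = T x (uidx m)`; in the
application `T = ξ♭` for a vector field `ξ`) we consider

* `deform G b T` — the components `A_{ji} = (∇T)_{ji} + (∇T)_{ij}` of the **deformation tensor**
  `A = 𝓛_{ξ} g = ∇_a ξ_b + ∇_b ξ_a` (Wald 1984, (C.2.16); the "Killing defect" of `ξ`);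
* `deformCurv G b x q m i a = Σ_{p,d} g^{pq} g^{md} R_{piad}` — the curvature coefficients
  `R^q{}_i{}_a{}^m` of the zeroth-order term.

Main results (everything is proved; the definitions are explicit finite sums):

* `IsMetricOn.tcov_curvT_apply` — Leibniz for the curvature term,
  `∇_p (R · T)_{qia} = Σ_{md} g^{md} ((∇_p R)_{qiad} T_m + R_{qiad} (∇T)_{pm})`;
* `IsMetricOn.tlap_tcov_unit_eq` — **the commutator** `(□∇T)_{ia} = (∇□T)_{ia} − (∇Ric · T)_{ia}
  − (Ric · ∇T)_{ia} − 2 Σ_{q,m} X^{qm}_{ia} (∇T)_{qm}` with the `∇Ric` and `Ric` terms displayed as the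
  contractions `Σ g^{pq} (∇_pR)_{qiad}` (once-contracted second Bianchi identity,
  `sum_ginv_tcov_rm4_contract`) and `Σ g^{pq} R_{piqd} = −Ric_{di}` (`sum_ginv_rm4_contract`), which
  vanish on a Ricci-flat `V` (`IsMetricOn.tlap_tcov_unit_eq_of_ricciFlat`);
* `IsMetricOn.deformCurv_add_comm` — the pair symmetry `R_{piad} + R_{paid}` makes `X^{qm}_{ia} + X^{qm}_{ai}`
  symmetric under the exchange of the raised pair `(q, m)`, so that the antisymmetric part of `∇T`
  drops out of the symmetrised zeroth-order term;
* **`IsMetricOn.tlap_deform_of_ricciFlat`** — on a Ricci-flat `V`,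
  `(□A)_{ia} = (∇□T)_{ia} + (∇□T)_{ai} − Σ_{q,m} (X^{qm}_{ia} + X^{qm}_{ai}) A_{qm}`, and
  **`IsMetricOn.tlap_deform_eq_of_tlap_eq_zero`** — if moreover `□T = 0` on `V` then
  `□A = −(X + Xᵗ) · A`: the deformation tensor of a solution of the wave equation on a vacuum
  background solves a linear homogeneous wave equation with the curvature as potential;
* `IsMetricOn.trace_tcov_deform_sub_half` — **the contracted Ricci identity**
  `Σ g^{pq} (∇_p A)_{qa} − ½ Σ g^{pq} (∇_a A)_{pq} = (□T)_a + Σ_{m,d} g^{md} Ric(b_d, b_a) T_m`, i.e.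
  `div A − ½ d(tr A) = □ξ♭ + Ric(ξ, ·)` (the once-contracted Ricci identity
  `∇^a(∇_a ξ_b + ∇_b ξ_a) − ∇_b ∇^a ξ_a = □ξ_b + R_{ba} ξ^a`; cf. Wald 1984, (C.3.6) for Killing `ξ`), which supplies the transversal part of
  the Cauchy data of `A` on a hypersurface.

This is the computation behind the propagation of Killing's equation off a Cauchy hypersurface —
"by the Ricci commutation formulas we get `□h̄ + 2 Riem · h̄ = 0`" for `h = 𝓛_X g`, `□X = 0`,
`Ric = 0` (Fischer–Marsden–Moncrief 1980, proof of Lemma 2.2, after Moncrief 1975, §III and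
Coll 1977): together with the vanishing of the Cauchy data of `A` forced by the KID equations and
uniqueness for linear wave equations it shows that Killing initial data develop into Killing
fields. No definition of `Prop` type is introduced.

## References

* A. E. Fischer, J. E. Marsden, V. Moncrief, *The structure of the space of solutions of
  Einstein's equations. I. One Killing field*, Ann. Inst. H. Poincaré A 33 (1980) 147–194, §2,
  Lemma 2.2 and its proof (p. 161–162). [FischerMarsdenMoncrief1980]
* V. Moncrief, *Spacetime symmetries and linearization stability of the Einstein equations. I*,
  J. Math. Phys. 16 (1975) 493–498, §III. [Moncrief1975]
* R. M. Wald, *General Relativity*, Chicago 1984, App. C, (C.2.16), (C.3.6). [Wald1984]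
* B. O'Neill, *Semi-Riemannian geometry with applications to relativity*, Academic Press 1983,
  Ch. 3, Prop. 3.36–3.37, Cor. 3.54. [ONeill1983]
-/

noncomputable section

open Set Filter ContinuousLinearMap Module Function
open scoped Topology ContDiff

namespace Literature.Geometry.Lorentzian

namespace MetricCoord

variable {E : Type*} [NormedAddCommGroup E] [NormedSpace ℝ E] {ι : Type*}

/-! ### Rank-one index bookkeeping -/

section Unit

/-- The index function of the single slot of a rank-one component field: `uidx m = (· ↦ m)`.
[folklore] -/
abbrev uidx (m : ι) : Unit → ι := fun _ ↦ m

/-- Every index function on `Unit` is a `uidx`. [folklore] -/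
theorem uidx_eta (I : Unit → ι) : uidx (I ()) = I := by
  funext u; rfl

/-- Updating the single slot. [folklore] -/
@[simp] theorem update_uidx (a m : ι) : update (uidx a) () m = uidx m := by
  funext u; cases u; simp

/-- Updating the single slot of an arbitrary index function on `Unit`. [folklore] -/
@[simp] theorem update_unit (I : Unit → ι) (m : ι) : update I () m = uidx m := by
  funext u; cases u; simp

/-- Swapping the two slots of `ocons j (uidx i)`. [folklore] -/
theorem ocons_uidx_comp_swap (j i : ι) :
    ocons j (uidx i) ∘ (Equiv.swap none (some ()) : Equiv.Perm (Option Unit)) = ocons i (uidx j) := by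
  funext o
  rcases o with _ | ⟨⟨⟩⟩
  · simp
  · simp

/-- Every index function on `Option Unit` is an `ocons j (uidx i)`. [folklore] -/
theorem exists_eq_ocons_uidx (J : Option Unit → ι) : ∃ j i, J = ocons j (uidx i) :=
  ⟨J none, J (some ()), by funext o; rcases o with _ | ⟨⟨⟩⟩ <;> rfl⟩

/-- Every index function on `Option (Option Unit)` is an `ocons p (ocons j (uidx i))`. [folklore] -/
theorem exists_eq_ocons_ocons_uidx (K : Option (Option Unit) → ι) :
    ∃ p j i, K = ocons p (ocons j (uidx i)) :=
  ⟨K none, K (some none), K (some (some ())), by funext o; rcases o with _ | _ | ⟨⟨⟩⟩ <;> rfl⟩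

end Unit

/-! ### The deformation tensor and the curvature coefficients -/

section Defs

variable [Fintype ι] (G : E → E →L[ℝ] E →L[ℝ] ℝ) (b : Basis ι ℝ E)

/-- **Components of the deformation tensor** of the covector field with components `T`:
`A_{ji} = (∇T)_{ji} + (∇T)_{ij}` (for `T = ξ♭`: `A = 𝓛_ξ g`, `A_{ab} = ∇_a ξ_b + ∇_b ξ_a`).
[cite: Wald1984, (C.2.16)] -/
def deform (T : E → (Unit → ι) → ℝ) : E → (Option Unit → ι) → ℝ :=
  tcov G b T + treindex (Equiv.swap none (some ())) (tcov G b T)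

variable [FiniteDimensional ℝ E]

/-- **The curvature acting on a covector field, lowered form**:
`(curvT T)_{qia} = Σ_{m,d} g^{md} R_{qiad} T_m = Σ_m R^m{}_{qia} T_m` (the field `ricTerm T ()` of
`CoordTensorRicciIdentity`, written through `rm4` and `ginv`). [cite: ONeill1983, Ch. 3, Prop. 3.36] -/
def curvT (T : E → (Unit → ι) → ℝ) : E → (Option (Option Unit) → ι) → ℝ :=
  fun y J ↦ ∑ m, ∑ d, ginv G b y m d * rm4 G b y ![J none, J (some none), J (some (some ())), d] *
    T y (uidx m)

/-- **The curvature coefficients of the deformation wave equation**: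
`X^{qm}_{ia} = Σ_{p,d} g^{pq} g^{md} R_{piad}` (`= R^q{}_{ia}{}^m` up to the placement of indices).
[cite: FischerMarsdenMoncrief1980, proof of Lemma 2.2] -/
def deformCurv (x : E) (q m i a : ι) : ℝ :=
  ∑ p, ∑ d, ginv G b x p q * ginv G b x m d * rm4 G b x ![p, i, a, d]

end Defs

/-! ### Unfolding lemmas -/

section Unfold

variable [Fintype ι] {G : E → E →L[ℝ] E →L[ℝ] ℝ} {b : Basis ι ℝ E} {V : Set E} {x : E}

/-- `A_{ji} = (∇T)_{ji} + (∇T)_{ij}`. [cite: Wald1984, (C.2.16)] -/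
theorem deform_apply (T : E → (Unit → ι) → ℝ) (x : E) (j i : ι) :
    deform G b T x (ocons j (uidx i)) = tcov G b T x (ocons j (uidx i)) + tcov G b T x (ocons i (uidx j)) := by
  simp only [deform, Pi.add_apply, treindex_apply, ocons_uidx_comp_swap]

/-- The deformation tensor is symmetric. [cite: Wald1984, (C.2.16)] -/
theorem deform_comm (T : E → (Unit → ι) → ℝ) (x : E) (j i : ι) :
    deform G b T x (ocons j (uidx i)) = deform G b T x (ocons i (uidx j)) := by
  rw [deform_apply, deform_apply, add_comm]

/-- `(∇T)_{pm} = ∂_p T_m − Σ_c Γ^c_{pm} T_c` for a rank-one field. [cite: ONeill1983, Ch. 2, Prop. 2.13] -/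
theorem tcov_apply_uidx (T : E → (Unit → ι) → ℝ) (x : E) (p m : ι) :
    tcov G b T x (ocons p (uidx m)) =
      fderiv ℝ (fun y ↦ T y (uidx m)) x (b p) - ∑ c, chrCoef G b x p m c * T x (uidx c) := by
  rw [tcov_apply_ocons]
  simp

variable [FiniteDimensional ℝ E]

/-- Unfolding lemma for `curvT` at prepended indices. [cite: ONeill1983, Ch. 3, Prop. 3.36] -/
theorem curvT_apply (T : E → (Unit → ι) → ℝ) (y : E) (q i a : ι) :
    curvT G b T y (ocons q (ocons i (uidx a))) =
      ∑ m, ∑ d, ginv G b y m d * rm4 G b y ![q, i, a, d] * T y (uidx m) := rfl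

/-- The deformation tensor of a smooth field is smooth on `V`. [folklore] -/
theorem IsMetricOn.tsmoothOn_deform [CompleteSpace E] (hG : IsMetricOn G V) {T : E → (Unit → ι) → ℝ}
    (hT : TSmoothOn T V) : TSmoothOn (deform G b T) V :=
  (hG.tsmoothOn_tcov hT).add ((hG.tsmoothOn_tcov hT).treindex _)

/-- `curvT T` is smooth on `V`. [folklore] -/
theorem IsMetricOn.tsmoothOn_curvT [CompleteSpace E] (hG : IsMetricOn G V) {T : E → (Unit → ι) → ℝ}
    (hT : TSmoothOn T V) : TSmoothOn (curvT G b T) V := by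
  intro J
  refine ContDiffOn.sum fun m _ ↦ ContDiffOn.sum fun d _ ↦ ?_
  exact ((hG.contDiffOn_ginv b m d).mul (hG.tsmoothOn_rm4 (b := b) _)).mul (hT _)

end Unfold

/-! ### The Ricci identity for rank one and two, written through `rm4` -/

section RicciIdentity

variable [Fintype ι] {G : E → E →L[ℝ] E →L[ℝ] ℝ} {b : Basis ι ℝ E} {V : Set E} {x : E}
  [CompleteSpace E] [FiniteDimensional ℝ E]

omit [CompleteSpace E] in
/-- `ricTerm T () = curvT T` on `V` (index raising `R^m{}_{qia} = Σ_d g^{md} R_{qiad}`).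
[cite: ONeill1983, Ch. 3, Prop. 3.36] -/
theorem IsMetricOn.ricTerm_unit_eq_curvT (hG : IsMetricOn G V) (T : E → (Unit → ι) → ℝ) :
    ∀ y ∈ V, ∀ J, ricTerm G b T () y J = curvT G b T y J := by
  intro y hy J
  obtain ⟨q, i, a, rfl⟩ := exists_eq_ocons_ocons_uidx J
  rw [ricTerm_apply_ocons, curvT_apply]
  refine Finset.sum_congr rfl fun m _ ↦ ?_
  rw [riemCoef_eq_sum_ginv b (hG.isInvertible y hy), Finset.sum_mul]
  refine Finset.sum_congr rfl fun d _ ↦ ?_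
  simp

/-- **The Ricci identity for a covector field**: `(∇∇T)_{qia} − (∇∇T)_{iqa} = −Σ_{m,d} g^{md} R_{qiad} T_m`,
as the identity of fields `tcov2Alt T = −curvT T` on `V`. [cite: ONeill1983, Ch. 3, Prop. 3.36] -/
theorem IsMetricOn.tcov2Alt_unit_eq (hG : IsMetricOn G V) {T : E → (Unit → ι) → ℝ} (hT : TSmoothOn T V) :
    ∀ y ∈ V, ∀ J, tcov2Alt G b T y J = -curvT G b T y J := by
  intro y hy J
  rw [hG.tcov2Alt_eq hT y hy J]
  simp only [Finset.univ_unique, PUnit.default_eq_unit, Finset.sum_singleton]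
  rw [hG.ricTerm_unit_eq_curvT T y hy J]

/-- **The Ricci identity for the rank-two field `∇T`**:
`(∇∇∇T)_{piqa} − (∇∇∇T)_{ipqa} = −Σ_{m,d} g^{md} (R_{piqd} (∇T)_{ma} + R_{piad} (∇T)_{qm})`.
[cite: ONeill1983, Ch. 3, Prop. 3.36] -/
theorem IsMetricOn.tcov2Alt_tcov_unit_apply (hG : IsMetricOn G V) {T : E → (Unit → ι) → ℝ}
    (hT : TSmoothOn T V) (hx : x ∈ V) (p i q a : ι) :
    tcov2Alt G b (tcov G b T) x (ocons p (ocons i (ocons q (uidx a)))) =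
      -∑ m, ∑ d, ginv G b x m d *
        (rm4 G b x ![p, i, q, d] * tcov G b T x (ocons m (uidx a)) +
          rm4 G b x ![p, i, a, d] * tcov G b T x (ocons q (uidx m))) := by
  have hi := hG.isInvertible x hx
  rw [hG.tcov2Alt_eq (hG.tsmoothOn_tcov hT) x hx]
  simp only [Fintype.sum_option, Finset.univ_unique, PUnit.default_eq_unit, Finset.sum_singleton,
    ricTerm_apply_ocons, ocons_none, ocons_some, update_ocons_none, update_ocons_some, update_uidx,
    neg_add_rev]
  rw [add_comm]
  simp only [riemCoef_eq_sum_ginv b hi, Finset.sum_mul, ← Finset.sum_add_distrib, ← Finset.sum_neg_distrib]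
  refine Finset.sum_congr rfl fun m _ ↦ Finset.sum_congr rfl fun d _ ↦ ?_
  simp only [uidx]
  ring

end RicciIdentity

/-! ### The covariant derivative of the curvature term: `∇(R · T) = (∇R) · T + R · ∇T` -/

section Leibniz

variable [Fintype ι] {G : E → E →L[ℝ] E →L[ℝ] ℝ} {b : Basis ι ℝ E} {V : Set E} {x : E}
  [CompleteSpace E] [FiniteDimensional ℝ E]

omit [CompleteSpace E] [FiniteDimensional ℝ E] in
/-- Cyclic reordering of a triple finite sum: the last index becomes the outermost. [folklore] -/
theorem sum₃_rotate {R : Type*} [AddCommMonoid R] (f : ι → ι → ι → R) :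
    ∑ m, ∑ d, ∑ c, f m d c = ∑ c, ∑ m, ∑ d, f m d c :=
  (Finset.sum_congr rfl fun _ _ ↦ Finset.sum_comm).trans Finset.sum_comm

omit [Fintype ι] [CompleteSpace E] [FiniteDimensional ℝ E] in
/-- `∂(g r t) = (∂g) r t + g (∂r) t + g r (∂t)` for real functions. [folklore] -/
theorem fderiv_mul₃_apply {g r t : E → ℝ} (hg : DifferentiableAt ℝ g x) (hr : DifferentiableAt ℝ r x)
    (ht : DifferentiableAt ℝ t x) (v : E) :
    fderiv ℝ (fun y ↦ g y * r y * t y) x v =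
      fderiv ℝ g x v * r x * t x + g x * fderiv ℝ r x v * t x + g x * r x * fderiv ℝ t x v := by
  have hgr : DifferentiableAt ℝ (fun y ↦ g y * r y) x := hg.mul hr
  rw [fderiv_fun_mul hgr ht, fderiv_fun_mul hg hr]
  simp only [_root_.add_apply, FunLike.coe_smul, Pi.smul_apply, smul_eq_mul]
  ring

/-- The derivative of the components of `curvT T` (product rule). [folklore] -/
theorem IsMetricOn.fderiv_curvT_apply (hG : IsMetricOn G V) {T : E → (Unit → ι) → ℝ}
    (hT : TSmoothOn T V) (hx : x ∈ V) (p q i a : ι) :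
    fderiv ℝ (fun y ↦ curvT G b T y (ocons q (ocons i (uidx a)))) x (b p) =
      ∑ m, ∑ d, (fderiv ℝ (fun y ↦ ginv G b y m d) x (b p) * rm4 G b x ![q, i, a, d] * T x (uidx m)
        + ginv G b x m d * fderiv ℝ (fun y ↦ rm4 G b y ![q, i, a, d]) x (b p) * T x (uidx m)
        + ginv G b x m d * rm4 G b x ![q, i, a, d] * fderiv ℝ (fun y ↦ T y (uidx m)) x (b p)) := by
  have hV := hG.isOpen
  have hgd : ∀ m d, DifferentiableAt ℝ (fun y ↦ ginv G b y m d) x := fun m d ↦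
    ((hG.contDiffOn_ginv b m d).contDiffAt (hV.mem_nhds hx)).differentiableAt (by simp)
  have hrd : ∀ d, DifferentiableAt ℝ (fun y ↦ rm4 G b y ![q, i, a, d]) x := fun d ↦
    (hG.tsmoothOn_rm4 (b := b)).differentiableAt hV hx _
  have hTd : ∀ m, DifferentiableAt ℝ (fun y ↦ T y (uidx m)) x := fun m ↦ hT.differentiableAt hV hx _
  have hprod : ∀ m d, DifferentiableAt ℝ
      (fun y ↦ ginv G b y m d * rm4 G b y ![q, i, a, d] * T y (uidx m)) x := fun m d ↦
    ((hgd m d).mul (hrd d)).mul (hTd m)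
  have hinner : ∀ m, DifferentiableAt ℝ
      (fun y ↦ ∑ d, ginv G b y m d * rm4 G b y ![q, i, a, d] * T y (uidx m)) x := fun m ↦
    DifferentiableAt.fun_sum fun d _ ↦ hprod m d
  have h : (fun y ↦ curvT G b T y (ocons q (ocons i (uidx a)))) =
      fun y ↦ ∑ m, ∑ d, ginv G b y m d * rm4 G b y ![q, i, a, d] * T y (uidx m) := rfl
  rw [h, fderiv_fun_sum fun m _ ↦ hinner m, FunLike.coe_sum, Finset.sum_apply]
  refine Finset.sum_congr rfl fun m _ ↦ ?_
  rw [fderiv_fun_sum fun d _ ↦ hprod m d, FunLike.coe_sum, Finset.sum_apply]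
  refine Finset.sum_congr rfl fun d _ ↦ ?_
  exact fderiv_mul₃_apply (hgd m d) (hrd d) (hTd m) (b p)

/-- **Leibniz rule for the curvature term**: `(∇_p (R · T))_{qia} = Σ_{m,d} g^{md} ((∇_p R)_{qiad} T_m
+ R_{qiad} (∇T)_{pm})` — the metric coefficients are parallel (`fderiv_ginv_eq_chrCoef`) and the
Christoffel corrections of the contracted slot cancel. [cite: ONeill1983, Ch. 2, Prop. 2.13] -/
theorem IsMetricOn.tcov_curvT_apply (hG : IsMetricOn G V) {T : E → (Unit → ι) → ℝ}
    (hT : TSmoothOn T V) (hx : x ∈ V) (p q i a : ι) :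
    tcov G b (curvT G b T) x (ocons p (ocons q (ocons i (uidx a)))) =
      ∑ m, ∑ d, ginv G b x m d * (tcov G b (rm4 G b) x (ocons p ![q, i, a, d]) * T x (uidx m)
        + rm4 G b x ![q, i, a, d] * tcov G b T x (ocons p (uidx m))) := by
  -- derivative identities for the three factors
  have hdg : ∀ m d, fderiv ℝ (fun y ↦ ginv G b y m d) x (b p) =
      -(∑ c, ginv G b x m c * chrCoef G b x p c d) - ∑ c, chrCoef G b x p c m * ginv G b x c d :=
    fun m d ↦ hG.fderiv_ginv_eq_chrCoef b hx m d p
  have hdr : ∀ d, fderiv ℝ (fun y ↦ rm4 G b y ![q, i, a, d]) x (b p) =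
      tcov G b (rm4 G b) x (ocons p ![q, i, a, d]) +
        (∑ c, chrCoef G b x p q c * rm4 G b x ![c, i, a, d] + ∑ c, chrCoef G b x p i c * rm4 G b x ![q, c, a, d]
          + ∑ c, chrCoef G b x p a c * rm4 G b x ![q, i, c, d] + ∑ c, chrCoef G b x p d c * rm4 G b x ![q, i, a, c]) := by
    intro d
    rw [tcov_apply_ocons, Fin.sum_univ_four]
    simp only [Matrix.cons_val_zero, Matrix.cons_val_one, Matrix.cons_val, update_vec4_zero,
      update_vec4_one, update_vec4_two, update_vec4_three]
    ring
  have hdT : ∀ m, fderiv ℝ (fun y ↦ T y (uidx m)) x (b p) =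
      tcov G b T x (ocons p (uidx m)) + ∑ c, chrCoef G b x p m c * T x (uidx c) := fun m ↦ by
    rw [tcov_apply_uidx]; ring
  -- expand the left-hand side
  rw [tcov_apply_ocons, hG.fderiv_curvT_apply hT hx]
  simp only [Fintype.sum_option, Finset.univ_unique, PUnit.default_eq_unit, Finset.sum_singleton,
    ocons_none, ocons_some, update_ocons_none, update_ocons_some, update_uidx]
  simp only [curvT_apply, hdg, hdr, hdT]
  simp only [mul_add, add_mul, sub_mul, neg_mul, Finset.sum_add_distrib, Finset.sum_sub_distrib,
    Finset.sum_neg_distrib, Finset.mul_sum, Finset.sum_mul]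
  simp only [show (uidx a : Unit → ι) PUnit.unit = a from rfl]
  -- the cancelling pairs and the regroupings, by reordering finite sums
  have hB4 : ∑ m, ∑ d, ∑ c, ginv G b x m d * (chrCoef G b x p d c * rm4 G b x ![q, i, a, c]) * T x (uidx m) =
      ∑ m, ∑ d, ∑ c, ginv G b x m c * chrCoef G b x p c d * rm4 G b x ![q, i, a, d] * T x (uidx m) := by
    refine Finset.sum_congr rfl fun m _ ↦ ?_
    rw [Finset.sum_comm]
    exact Finset.sum_congr rfl fun d _ ↦ Finset.sum_congr rfl fun c _ ↦ by ring
  have hA4 : ∑ m, ∑ d, ∑ c, ginv G b x m d * rm4 G b x ![q, i, a, d] * (chrCoef G b x p m c * T x (uidx c)) =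
      ∑ m, ∑ d, ∑ c, chrCoef G b x p c m * ginv G b x c d * rm4 G b x ![q, i, a, d] * T x (uidx m) := by
    conv_lhs => rw [sum₃_rotate]
    refine Finset.sum_congr rfl fun m _ ↦ ?_
    rw [Finset.sum_comm]
    exact Finset.sum_congr rfl fun d _ ↦ Finset.sum_congr rfl fun c _ ↦ by ring
  have hC1 : ∑ c, ∑ m, ∑ d, chrCoef G b x p q c * (ginv G b x m d * rm4 G b x ![c, i, a, d] * T x (uidx m)) =
      ∑ m, ∑ d, ∑ c, ginv G b x m d * (chrCoef G b x p q c * rm4 G b x ![c, i, a, d]) * T x (uidx m) := by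
    conv_lhs => rw [sum₃_rotate, sum₃_rotate]
    exact Finset.sum_congr rfl fun m _ ↦ Finset.sum_congr rfl fun d _ ↦ Finset.sum_congr rfl fun c _ ↦ by ring
  have hC2 : ∑ c, ∑ m, ∑ d, chrCoef G b x p i c * (ginv G b x m d * rm4 G b x ![q, c, a, d] * T x (uidx m)) =
      ∑ m, ∑ d, ∑ c, ginv G b x m d * (chrCoef G b x p i c * rm4 G b x ![q, c, a, d]) * T x (uidx m) := by
    conv_lhs => rw [sum₃_rotate, sum₃_rotate]
    exact Finset.sum_congr rfl fun m _ ↦ Finset.sum_congr rfl fun d _ ↦ Finset.sum_congr rfl fun c _ ↦ by ring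
  have hC3 : ∑ c, ∑ m, ∑ d, chrCoef G b x p a c * (ginv G b x m d * rm4 G b x ![q, i, c, d] * T x (uidx m)) =
      ∑ m, ∑ d, ∑ c, ginv G b x m d * (chrCoef G b x p a c * rm4 G b x ![q, i, c, d]) * T x (uidx m) := by
    conv_lhs => rw [sum₃_rotate, sum₃_rotate]
    exact Finset.sum_congr rfl fun m _ ↦ Finset.sum_congr rfl fun d _ ↦ Finset.sum_congr rfl fun c _ ↦ by ring
  have hM1 : ∑ m, ∑ d, ginv G b x m d * tcov G b (rm4 G b) x (ocons p ![q, i, a, d]) * T x (uidx m) =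
      ∑ m, ∑ d, ginv G b x m d * (tcov G b (rm4 G b) x (ocons p ![q, i, a, d]) * T x (uidx m)) :=
    Finset.sum_congr rfl fun m _ ↦ Finset.sum_congr rfl fun d _ ↦ by ring
  have hM2 : ∑ m, ∑ d, ginv G b x m d * rm4 G b x ![q, i, a, d] * tcov G b T x (ocons p (uidx m)) =
      ∑ m, ∑ d, ginv G b x m d * (rm4 G b x ![q, i, a, d] * tcov G b T x (ocons p (uidx m))) :=
    Finset.sum_congr rfl fun m _ ↦ Finset.sum_congr rfl fun d _ ↦ by ring
  rw [hB4, hA4, hC1, hC2, hC3, hM1, hM2]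
  ring

end Leibniz

/-! ### Contractions of the curvature and of its covariant derivative -/

section Contract

variable [Fintype ι] {G : E → E →L[ℝ] E →L[ℝ] ℝ} {b : Basis ι ℝ E} {V : Set E} {x : E}
  [CompleteSpace E] [FiniteDimensional ℝ E]

omit [CompleteSpace E] [FiniteDimensional ℝ E] in
/-- Cyclic reordering of a fourfold finite sum: the last index becomes the outermost. [folklore] -/
theorem sum₄_rotate {R : Type*} [AddCommMonoid R] (f : ι → ι → ι → ι → R) :
    ∑ p, ∑ q, ∑ m, ∑ d, f p q m d = ∑ d, ∑ p, ∑ q, ∑ m, f p q m d :=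
  (Finset.sum_congr rfl fun _ _ ↦ sum₃_rotate _).trans Finset.sum_comm

omit [CompleteSpace E] in
/-- **`Σ_{pq} g^{pq} R_{piqd} = −Ric(b_d, b_i)`** (the Ricci contraction).
[cite: ONeill1983, Ch. 3, Lemma 3.52] -/
theorem IsMetricOn.sum_ginv_rm4_contract (hG : IsMetricOn G V) (hx : x ∈ V) (i d : ι) :
    ∑ p, ∑ q, ginv G b x p q * rm4 G b x ![p, i, q, d] = -ricAt G x (b d) (b i) := by
  simpa only [rm4_vec] using hG.sum_ginv_apply_riemAt b hx (b i) (b d)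

/-- **`Σ_{pq} g^{pq} (∇_p R)_{qiad} = −((∇_{b_a} Ric)(b_d, b_i) − (∇_{b_d} Ric)(b_a, b_i))`** (the
once-contracted second Bianchi identity, `CoordCurvatureLaplacian`).
[cite: ONeill1983, Ch. 3, Prop. 3.37] -/
theorem IsMetricOn.sum_ginv_tcov_rm4_contract (hG : IsMetricOn G V) (hx : x ∈ V) (i a d : ι) :
    ∑ p, ∑ q, ginv G b x p q * tcov G b (rm4 G b) x (ocons p ![q, i, a, d]) =
      -(cov₂At G (ricAt G) x (b a) (b d) (b i) - cov₂At G (ricAt G) x (b d) (b a) (b i)) := by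
  rw [← hG.sum_ginv_apply_covRiemAt b hx (b i) (b a) (b d), ← Finset.sum_neg_distrib]
  refine Finset.sum_congr rfl fun p _ ↦ ?_
  rw [← Finset.sum_neg_distrib]
  refine Finset.sum_congr rfl fun q _ ↦ ?_
  rw [hG.tcov_rm4 b hx, covRiemAt_swap x (b p) (b i) (b q)]
  simp

omit [Fintype ι] [CompleteSpace E] in
/-- On a Ricci-flat `V` the covariant derivative of the Ricci form vanishes. [folklore] -/
theorem cov₂At_ricAt_eq_zero_of_ricciFlat (hV : IsOpen V) (hRic : ∀ y ∈ V, ricAt G y = 0) (hx : x ∈ V) :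
    cov₂At G (ricAt G) x = 0 := by
  have hev : ricAt G =ᶠ[𝓝 x] fun _ ↦ (0 : E →L[ℝ] E →L[ℝ] ℝ) :=
    Filter.eventually_of_mem (hV.mem_nhds hx) fun y hy ↦ hRic y hy
  ext W Y Z
  rw [cov₂At_apply, hev.fderiv_eq, hRic x hx]
  simp

end Contract

/-! ### The commutator `□∇T − ∇□T` for a covector field and the wave equation of `A` -/

section Wave

variable [Fintype ι] {G : E → E →L[ℝ] E →L[ℝ] ℝ} {b : Basis ι ℝ E} {V : Set E} {x : E}
  [CompleteSpace E] [FiniteDimensional ℝ E]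

/-- **The commutator of the d'Alembertian with the covariant derivative on a covector field**:
`(□∇T)_{ia} = (∇□T)_{ia} − Σ_{md} g^{md} (Σ_{pq} g^{pq} (∇_pR)_{qiad}) T_m
  − Σ_{md} g^{md} (Σ_{pq} g^{pq} R_{piqd}) (∇T)_{ma} − 2 Σ_{qm} X^{qm}_{ia} (∇T)_{qm}`
(Ricci identities for `T` and `∇T`, Leibniz, and the trace; the second and third terms are the
`∇Ric` and `Ric` terms, absent in vacuum). [cite: FischerMarsdenMoncrief1980, proof of Lemma 2.2] -/
theorem IsMetricOn.tlap_tcov_unit_eq (hG : IsMetricOn G V) {T : E → (Unit → ι) → ℝ}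
    (hT : TSmoothOn T V) (hx : x ∈ V) (i a : ι) :
    tlap G b (tcov G b T) x (ocons i (uidx a)) =
      tcov G b (tlap G b T) x (ocons i (uidx a))
        - ∑ m, ∑ d, ginv G b x m d *
            (∑ p, ∑ q, ginv G b x p q * tcov G b (rm4 G b) x (ocons p ![q, i, a, d])) * T x (uidx m)
        - ∑ m, ∑ d, ginv G b x m d *
            (∑ p, ∑ q, ginv G b x p q * rm4 G b x ![p, i, q, d]) * tcov G b T x (ocons m (uidx a))
        - 2 * ∑ q, ∑ m, deformCurv G b x q m i a * tcov G b T x (ocons q (uidx m)) := by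
  have hV := hG.isOpen
  have hi := hG.isInvertible x hx
  have hs := hG.symm x hx
  have hgs : ∀ p q, ginv G b x p q = ginv G b x q p := fun p q ↦ ginv_comm b hi hs p q
  have hcomm := hG.tlap_tcov_sub_tcov_tlap (b := b) hT hx i (uidx a)
  rw [sub_eq_iff_eq_add'] at hcomm
  have h1 : ∀ p q, (tcov G b (tcov2Alt G b T)
      + treindex (Equiv.swap (some none) (some (some none))) (tcov2Alt G b (tcov G b T)))
        x (ocons p (ocons q (ocons i (uidx a)))) =
      -tcov G b (curvT G b T) x (ocons p (ocons q (ocons i (uidx a))))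
        + tcov2Alt G b (tcov G b T) x (ocons p (ocons i (ocons q (uidx a)))) := by
    intro p q
    simp only [Pi.add_apply, treindex_apply, ocons_ocons_ocons_comp_swap]
    congr 1
    rw [tcov_congr hV (S := tcov2Alt G b T) (T := -curvT G b T)
      (fun y hy J ↦ by rw [Pi.neg_apply]; exact hG.tcov2Alt_unit_eq hT y hy J) hx,
      tcov_neg_apply hV (hG.tsmoothOn_curvT hT) hx]
  rw [hcomm, ttr_apply]
  simp only [h1, hG.tcov_curvT_apply hT hx, hG.tcov2Alt_tcov_unit_apply hT hx, deformCurv]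
  simp only [mul_add, mul_neg, Finset.sum_add_distrib, Finset.sum_neg_distrib, Finset.mul_sum,
    Finset.sum_mul]
  -- regroup the four fourfold sums
  have hL1 : ∑ p, ∑ q, ∑ m, ∑ d, ginv G b x p q *
        (ginv G b x m d * (tcov G b (rm4 G b) x (ocons p ![q, i, a, d]) * T x (uidx m))) =
      ∑ m, ∑ d, ∑ p, ∑ q, ginv G b x m d *
        (ginv G b x p q * tcov G b (rm4 G b) x (ocons p ![q, i, a, d])) * T x (uidx m) := by
    conv_lhs => rw [sum₄_rotate, sum₄_rotate]
    exact Finset.sum_congr rfl fun m _ ↦ Finset.sum_congr rfl fun d _ ↦ Finset.sum_congr rfl fun p _ ↦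
      Finset.sum_congr rfl fun q _ ↦ by ring
  have hL3 : ∑ p, ∑ q, ∑ m, ∑ d, ginv G b x p q *
        (ginv G b x m d * (rm4 G b x ![p, i, q, d] * tcov G b T x (ocons m (uidx a)))) =
      ∑ m, ∑ d, ∑ p, ∑ q, ginv G b x m d *
        (ginv G b x p q * rm4 G b x ![p, i, q, d]) * tcov G b T x (ocons m (uidx a)) := by
    conv_lhs => rw [sum₄_rotate, sum₄_rotate]
    exact Finset.sum_congr rfl fun m _ ↦ Finset.sum_congr rfl fun d _ ↦ Finset.sum_congr rfl fun p _ ↦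
      Finset.sum_congr rfl fun q _ ↦ by ring
  have hL4 : ∑ p, ∑ q, ∑ m, ∑ d, ginv G b x p q *
        (ginv G b x m d * (rm4 G b x ![p, i, a, d] * tcov G b T x (ocons q (uidx m)))) =
      ∑ q, ∑ m, ∑ p, ∑ d, ginv G b x p q * ginv G b x m d * rm4 G b x ![p, i, a, d] *
        tcov G b T x (ocons q (uidx m)) := by
    conv_lhs => rw [Finset.sum_comm]
    refine Finset.sum_congr rfl fun q _ ↦ ?_
    rw [Finset.sum_comm]
    exact Finset.sum_congr rfl fun m _ ↦ Finset.sum_congr rfl fun p _ ↦ Finset.sum_congr rfl fun d _ ↦ by ring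
  have hL2 : ∑ p, ∑ q, ∑ m, ∑ d, ginv G b x p q *
        (ginv G b x m d * (rm4 G b x ![q, i, a, d] * tcov G b T x (ocons p (uidx m)))) =
      ∑ q, ∑ m, ∑ p, ∑ d, ginv G b x p q * ginv G b x m d * rm4 G b x ![p, i, a, d] *
        tcov G b T x (ocons q (uidx m)) := by
    refine Finset.sum_congr rfl fun p _ ↦ ?_
    rw [Finset.sum_comm]
    exact Finset.sum_congr rfl fun m _ ↦ Finset.sum_congr rfl fun q _ ↦ Finset.sum_congr rfl fun d _ ↦ by
      rw [hgs p q]; ring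
  have hR3 : ∑ q, ∑ m, ∑ p, ∑ d, 2 * (ginv G b x p q * ginv G b x m d * rm4 G b x ![p, i, a, d] *
        tcov G b T x (ocons q (uidx m))) =
      2 * ∑ q, ∑ m, ∑ p, ∑ d, ginv G b x p q * ginv G b x m d * rm4 G b x ![p, i, a, d] *
        tcov G b T x (ocons q (uidx m)) := by
    simp only [Finset.mul_sum]
  rw [hL1, hL3, hL4, hL2, hR3]
  ring

/-- **Ricci-flat case of the commutator**: on a Ricci-flat `V`,
`(□∇T)_{ia} = (∇□T)_{ia} − 2 Σ_{qm} X^{qm}_{ia} (∇T)_{qm}`.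
[cite: FischerMarsdenMoncrief1980, proof of Lemma 2.2] -/
theorem IsMetricOn.tlap_tcov_unit_eq_of_ricciFlat (hG : IsMetricOn G V)
    (hRic : ∀ y ∈ V, ricAt G y = 0) {T : E → (Unit → ι) → ℝ} (hT : TSmoothOn T V) (hx : x ∈ V)
    (i a : ι) :
    tlap G b (tcov G b T) x (ocons i (uidx a)) =
      tcov G b (tlap G b T) x (ocons i (uidx a))
        - 2 * ∑ q, ∑ m, deformCurv G b x q m i a * tcov G b T x (ocons q (uidx m)) := by
  rw [hG.tlap_tcov_unit_eq hT hx]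
  simp only [hG.sum_ginv_tcov_rm4_contract hx, hG.sum_ginv_rm4_contract hx, hRic x hx,
    cov₂At_ricAt_eq_zero_of_ricciFlat hG.isOpen hRic hx]
  simp

omit [Fintype ι] [FiniteDimensional ℝ E] in
/-- **Pair symmetry in the outer slots**: `R_{diap} = R_{paid}`. [cite: ONeill1983, Ch. 3, Prop. 3.36] -/
theorem IsMetricOn.rm4_swap_outer (hG : IsMetricOn G V) (hx : x ∈ V) (d i a p : ι) :
    rm4 G b x ![d, i, a, p] = rm4 G b x ![p, a, i, d] := by
  simp only [rm4_vec]
  rw [hG.apply_riemAt_pair_comm hx (b d) (b i) (b a) (b p), riemAt_swap G x (b p) (b a),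
    _root_.neg_apply, map_neg, _root_.neg_apply,
    hG.apply_riemAt_swap hx (b p) (b a) (b i) (b d), neg_neg]

/-- **Symmetry of the symmetrised curvature coefficients**:
`X^{qm}_{ia} + X^{qm}_{ai} = X^{mq}_{ia} + X^{mq}_{ai}` (pair symmetry of the curvature tensor), the
reason why the antisymmetric part of `∇T` drops out of `□A`.
[cite: FischerMarsdenMoncrief1980, proof of Lemma 2.2] -/
theorem IsMetricOn.deformCurv_add_comm (hG : IsMetricOn G V) (hx : x ∈ V) (q m i a : ι) :
    deformCurv G b x q m i a + deformCurv G b x q m a i =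
      deformCurv G b x m q i a + deformCurv G b x m q a i := by
  have hi := hG.isInvertible x hx
  have hs := hG.symm x hx
  have hgs : ∀ p q, ginv G b x p q = ginv G b x q p := fun p q ↦ ginv_comm b hi hs p q
  simp only [deformCurv, ← Finset.sum_add_distrib]
  conv_rhs => rw [Finset.sum_comm]
  refine Finset.sum_congr rfl fun p _ ↦ Finset.sum_congr rfl fun d _ ↦ ?_
  rw [hG.rm4_swap_outer hx d i a p, hG.rm4_swap_outer hx d a i p, hgs d m, hgs q p]
  ring

/-- `□` of the transposed tensor is the transpose of `□`: `(□A)_{ia}` for `A = deform T` splits as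
`(□∇T)_{ia} + (□∇T)_{ai}`. [folklore] -/
theorem IsMetricOn.tlap_deform_apply (hG : IsMetricOn G V) {T : E → (Unit → ι) → ℝ}
    (hT : TSmoothOn T V) (hx : x ∈ V) (i a : ι) :
    tlap G b (deform G b T) x (ocons i (uidx a)) =
      tlap G b (tcov G b T) x (ocons i (uidx a)) + tlap G b (tcov G b T) x (ocons a (uidx i)) := by
  rw [deform, hG.tlap_add_apply (hG.tsmoothOn_tcov hT) ((hG.tsmoothOn_tcov hT).treindex _) hx,
    tlap_treindex, treindex_apply, ocons_uidx_comp_swap]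

/-- **The wave equation of the deformation tensor on a Ricci-flat background**:
`(□A)_{ia} = (∇□T)_{ia} + (∇□T)_{ai} − Σ_{q,m} (X^{qm}_{ia} + X^{qm}_{ai}) A_{qm}` — the antisymmetric
part of `∇T` drops out by `deformCurv_add_comm`. For `T = ξ♭` this is
`□(𝓛_ξ g) = 𝓛_{□ξ} g + 2 Rm · 𝓛_ξ g` (Fischer–Marsden–Moncrief 1980, proof of Lemma 2.2: "by the
Ricci commutation formulas"). [cite: FischerMarsdenMoncrief1980, proof of Lemma 2.2] -/
theorem IsMetricOn.tlap_deform_of_ricciFlat (hG : IsMetricOn G V) (hRic : ∀ y ∈ V, ricAt G y = 0)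
    {T : E → (Unit → ι) → ℝ} (hT : TSmoothOn T V) (hx : x ∈ V) (i a : ι) :
    tlap G b (deform G b T) x (ocons i (uidx a)) =
      tcov G b (tlap G b T) x (ocons i (uidx a)) + tcov G b (tlap G b T) x (ocons a (uidx i))
        - ∑ q, ∑ m, (deformCurv G b x q m i a + deformCurv G b x q m a i) *
            deform G b T x (ocons q (uidx m)) := by
  rw [hG.tlap_deform_apply hT hx, hG.tlap_tcov_unit_eq_of_ricciFlat hRic hT hx,
    hG.tlap_tcov_unit_eq_of_ricciFlat hRic hT hx]
  -- symmetrisation: `2 Σ S^{qm} (∇T)_{qm} = Σ S^{qm} ((∇T)_{qm} + (∇T)_{mq})` for symmetric `S`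
  have hS : ∀ q m, deformCurv G b x q m i a + deformCurv G b x q m a i =
      deformCurv G b x m q i a + deformCurv G b x m q a i := fun q m ↦ hG.deformCurv_add_comm hx q m i a
  have hswap : ∑ q, ∑ m, (deformCurv G b x q m i a + deformCurv G b x q m a i) * tcov G b T x (ocons m (uidx q)) =
      ∑ q, ∑ m, (deformCurv G b x q m i a + deformCurv G b x q m a i) * tcov G b T x (ocons q (uidx m)) := by
    rw [Finset.sum_comm]
    exact Finset.sum_congr rfl fun q _ ↦ Finset.sum_congr rfl fun m _ ↦ by rw [hS m q]
  simp only [deform_apply, mul_add, Finset.sum_add_distrib]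
  rw [hswap]
  simp only [add_mul, Finset.sum_add_distrib]
  ring

/-- **Killing propagation, the wave equation**: if `Ric = 0` and `□T = 0` on `V` then the
deformation tensor solves the linear homogeneous wave equation
`(□A)_{ia} = −Σ_{q,m} (X^{qm}_{ia} + X^{qm}_{ai}) A_{qm}` on `V`.
[cite: FischerMarsdenMoncrief1980, proof of Lemma 2.2] -/
theorem IsMetricOn.tlap_deform_eq_of_tlap_eq_zero (hG : IsMetricOn G V) (hRic : ∀ y ∈ V, ricAt G y = 0)
    {T : E → (Unit → ι) → ℝ} (hT : TSmoothOn T V) (hwave : ∀ y ∈ V, ∀ I, tlap G b T y I = 0)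
    (hx : x ∈ V) (i a : ι) :
    tlap G b (deform G b T) x (ocons i (uidx a)) =
      -∑ q, ∑ m, (deformCurv G b x q m i a + deformCurv G b x q m a i) *
        deform G b T x (ocons q (uidx m)) := by
  have hV := hG.isOpen
  have h0 : ∀ J, tcov G b (tlap G b T) x J = 0 := fun J ↦ by
    rw [tcov_congr hV (S := tlap G b T) (T := 0) (fun y hy I ↦ hwave y hy I) hx, tcov_zero]
    rfl
  rw [hG.tlap_deform_of_ricciFlat hRic hT hx, h0, h0]
  ring

end Wave

/-! ### The contracted identity `div A − ½ d(tr A) = □T + Ric · T` -/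

section Div

variable [Fintype ι] {G : E → E →L[ℝ] E →L[ℝ] ℝ} {b : Basis ι ℝ E} {V : Set E} {x : E}
  [CompleteSpace E] [FiniteDimensional ℝ E]

/-- `(∇_p A)_{qa} = (∇∇T)_{pqa} + (∇∇T)_{paq}`. [cite: Wald1984, (C.2.16)] -/
theorem IsMetricOn.tcov_deform_apply (hG : IsMetricOn G V) {T : E → (Unit → ι) → ℝ}
    (hT : TSmoothOn T V) (hx : x ∈ V) (p q a : ι) :
    tcov G b (deform G b T) x (ocons p (ocons q (uidx a))) =
      tcov G b (tcov G b T) x (ocons p (ocons q (uidx a))) + tcov G b (tcov G b T) x (ocons p (ocons a (uidx q))) := by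
  rw [deform, tcov_add_apply hG.isOpen (hG.tsmoothOn_tcov hT) ((hG.tsmoothOn_tcov hT).treindex _) hx,
    tcov_treindex, treindex_apply, ocons_comp_optionCongr, ocons_uidx_comp_swap]

omit [CompleteSpace E] in
/-- **The contracted Ricci identity for the deformation tensor** (`div A − ½ ∇ tr A = □T + Ric · T`):
`Σ_{pq} g^{pq} (∇_p A)_{qa} − ½ Σ_{pq} g^{pq} (∇_a A)_{pq} = (□T)_a + Σ_{m,d} g^{md} Ric(b_d, b_a) T_m`
(the once-contracted Ricci identity `∇^a(∇_a ξ_b + ∇_b ξ_a) − ∇_b ∇^a ξ_a = □ξ_b + R_{ba} ξ^a`, which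
makes `A = 𝓛_ξ g` of a solution of `□ξ + Ric·ξ = 0` automatically harmonic-gauged; Fischer–Marsden–Moncrief
1980, proof of Lemma 2.2, Steps 4–5). [cite: FischerMarsdenMoncrief1980, proof of Lemma 2.2] -/
theorem IsMetricOn.trace_tcov_deform_sub_half (hG : IsMetricOn G V) {T : E → (Unit → ι) → ℝ}
    (hT : TSmoothOn T V) (hx : x ∈ V) (a : ι) :
    ∑ p, ∑ q, ginv G b x p q * tcov G b (deform G b T) x (ocons p (ocons q (uidx a)))
      - (1 / 2) * ∑ p, ∑ q, ginv G b x p q * tcov G b (deform G b T) x (ocons a (ocons p (uidx q))) =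
      tlap G b T x (uidx a) + ∑ m, ∑ d, ginv G b x m d * ricAt G x (b d) (b a) * T x (uidx m) := by
  have hi := hG.isInvertible x hx
  have hs := hG.symm x hx
  have hgs : ∀ p q, ginv G b x p q = ginv G b x q p := fun p q ↦ ginv_comm b hi hs p q
  -- the symmetric trace of `(∇_a A)_{pq}`
  have hsym : ∑ p, ∑ q, ginv G b x p q * tcov G b (deform G b T) x (ocons a (ocons p (uidx q))) =
      2 * ∑ p, ∑ q, ginv G b x p q * tcov G b (tcov G b T) x (ocons a (ocons p (uidx q))) := by
    simp only [hG.tcov_deform_apply hT hx, mul_add, Finset.sum_add_distrib, two_mul]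
    congr 1
    rw [Finset.sum_comm]
    exact Finset.sum_congr rfl fun p _ ↦ Finset.sum_congr rfl fun q _ ↦ by rw [hgs q p]
  -- the Ricci identity `(∇∇T)_{paq} − (∇∇T)_{apq} = −(curvT T)_{paq}` and its trace
  have hR : ∀ p q, tcov G b (tcov G b T) x (ocons p (ocons a (uidx q))) =
      tcov G b (tcov G b T) x (ocons a (ocons p (uidx q))) - curvT G b T x (ocons p (ocons a (uidx q))) := by
    intro p q
    have h := hG.tcov2Alt_unit_eq (b := b) hT x hx (ocons p (ocons a (uidx q)))
    rw [tcov2Alt_apply_ocons] at h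
    linarith
  have htr : ∑ p, ∑ q, ginv G b x p q * curvT G b T x (ocons p (ocons a (uidx q))) =
      -∑ m, ∑ d, ginv G b x m d * ricAt G x (b d) (b a) * T x (uidx m) := by
    simp only [curvT_apply, Finset.mul_sum, ← Finset.sum_neg_distrib]
    rw [sum₄_rotate, sum₄_rotate]
    refine Finset.sum_congr rfl fun m _ ↦ Finset.sum_congr rfl fun d _ ↦ ?_
    have hc := hG.sum_ginv_rm4_contract (b := b) hx a d
    rw [show ∑ p, ∑ q, ginv G b x p q * (ginv G b x m d * rm4 G b x ![p, a, q, d] * T x (uidx m)) =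
        ginv G b x m d * T x (uidx m) * ∑ p, ∑ q, ginv G b x p q * rm4 G b x ![p, a, q, d] by
      simp only [Finset.mul_sum]
      exact Finset.sum_congr rfl fun p _ ↦ Finset.sum_congr rfl fun q _ ↦ by ring, hc]
    ring
  rw [hsym, tlap_apply]
  simp only [hG.tcov_deform_apply hT hx, hR, mul_add, mul_sub, Finset.sum_add_distrib,
    Finset.sum_sub_distrib, htr]
  ring

end Div

end MetricCoord

end Literature.Geometry.Lorentzian

end
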